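import Summits.AtomisticToContinuum.HydrodynamicLimit.Theorems.DiluteSelfConsistency.Negative.Quantifiers
import Summits.AtomisticToContinuum.HydrodynamicLimit.Theorems.DiluteSelfConsistency.Negative.ProfileUniform
import Summits.AtomisticToContinuum.HydrodynamicLimit.Theorems.DiluteSelfConsistency.Negative.Tightness
-- (pending farm build) import Summits.AtomisticToContinuum.HydrodynamicLimit.Theorems.DiluteSelfConsistency.Negative.AlexanderRange
import Summits.AtomisticToContinuum.HydrodynamicLimit.Theorems.DenseExcursion.Negative.AtTimeZero

/-!
# Disproof of `DiluteSelfConsistency` (stmt-AtomisticToContinuum-3091) — standing disprover's work file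

Crux `Summit.AtomisticToContinuum.HydrodynamicLimit.Theses.ImplosionDichotomy.DiluteSelfConsistency` (rank 3 of route
`ImplosionDichotomy`; also consumed by JaynesSqueeze `h₅`, TwoClocks `hS`): for every `η > 0` and all continuous positive
profiles `(a₀, u₀, θ₀)` there is `σ₀ > 0` such that for `0 < σ < σ₀` every classical hard-sphere-Euler solution on
`[0, T)` tied at `t = 0` to the local Gibbs laws keeps packing `ρ_t(x)σ³ < η` on `[0, T) × 𝕋³`.
Seat refuter-cdisprove-stmt-AtomisticToContinuum-3091-0, cycle 1 (2026-08-17). This file is an INDEX: every finding of the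
cycle is LANDED under `Theorems/DiluteSelfConsistency/Negative/` (imported above; sorry-free, axioms
`propext / Classical.choice / Quot.sound`) and is re-exported here by name, followed by the census `why_it_resists`.

VERDICT (cycle 1): **RESISTS A CHEAP KILL; EXPECTED FALSE IN SUBSTANCE.** `DiluteSelfConsistency ↔ ¬ DenseExcursion` is
LANDED (`not_denseExcursion_iff_diluteSelfConsistency`), so a disproof of this crux IS a proof of the rank-2 crux
`DenseExcursion` (tuned hard-sphere implosion), whose standing record (`Cruxes/DenseExcursion/Disproof.lean` gen 4 §8,
`RaceResults.md`, lines r2-one-mode-two-conditions / kidder-knob-melnikov, `Cruxes/DiluteSelfConsistency/NOTES.md` =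
ideator-1 decision memo) says: numerically TRUE (twice-tuned σ-independent Kidder-knob datum at SS(r₂) tracks to central
packing ≈ 0.5), formally open behind ForcedModulationStability + a certified Melnikov common zero — XL, not a cycle-1
object. No junk route exists: the tie PINS the data (`PolynomialCompressionPDE.admissible_iff_data`), flows exist
(Alexander), the EOS is analytic at low density (`hsEosLowDensity_proof`), classical solutions are unique
(`IsHardSphereEulerSolution.unique_of_smooth_eos`); the crux is the particle-free PDE statement
"`limsup_{σ→0} σ³ sup_{t<T*_σ} ‖ρ_σ(t)‖∞ = 0` for the pinned data `(rhoLim (profileOf a₀) σ, u₀, θ₀)`, profile by profile".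

FINDINGS OF THIS CYCLE:
* §1 LOAD-BEARING MAP (`Negative/Quantifiers.lean`, p134247 @ b4bca8cad2cd): the hypothesis class is INHABITED at every
  small `σ` (`exists_admissible_restState` — homogeneous rest state of LLN density `rhoLim (profileOf 1) σ > 0`, tied
  through Alexander's flows; `not_diluteSelfConsistencyVacuous`); `0 < η` is load-bearing
  (`diluteSelfConsistency_false_without_level_pos`); `σ₀` must depend on `η` (`not_diluteSelfConsistencyLevelUniform`);
  `a₀ > 0`, `θ₀ > 0` and the tie are load-bearing (`…_false_without_activity_pos / _temperature_pos / _untied`, re-typed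
  from the landed DE §6 lemmas); NO QUANTITATIVE UPGRADE: neither a polynomial rate `packing < σ^(3-κ)` nor a σ-uniform
  density bound `ρ ≤ M(profiles)` (`not_diluteSelfConsistencyPolynomialRate / …BoundedDensity`, from the PROVED
  `polynomialCompression_proof`).
* §2 QUANTIFIER ORDER (`Negative/ProfileUniform.lean`, p134691 @ f7ba8206bfd2): `σ₀` CANNOT be chosen before the
  profiles — `not_diluteSelfConsistencyProfileUniform`. Witness at `t = 0`, no implosion: tall smooth activity peak
  `a = 1 + kernel ε` (`M = sup a/∫a ≥ c₀/(2ε³)`), `σ³ := λ*/(v₁M)`, pinned density `≥ (3/4)M` at the peak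
  (`PolynomialCompressionStatics.abs_rhoLim_sub_β_le`), packing `≥ 3λ*/(4v₁) > η* = λ*/(2v₁)`. Importable by-products:
  `tendstoHydroFieldsAt_zero_of_small` (the `t = 0` tie under the EXPLICIT smallness `e·2Mv₁σ³ ≤ 1/32` — no
  profile-dependent threshold; η₀-uniform statics `UniformLGC.*`, stmt-14445 PROVED) and `exists_admissible_of_small`
  (ADMISSIBLE classical solutions with NON-CONSTANT density from any smooth positive activity under explicit smallness:
  `hsEuler_localExistence_holds` on `hsEosLowDensity_proof`, smoothness by `stub_staticsSmoothRate`).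
* §1b SMALLNESS OF `σ` (`Negative/AlexanderRange.lean`, p135124 @ 9bde52ace481): replacing `∃ σ₀, ∀ σ < σ₀` by
  Alexander's flow range `∀ σ < 1/2` makes the crux FALSE at `η = 10⁻⁴` — explicit statics at `σ = 1/20` for the
  homogeneous profiles (`e·2Mv₁σ³ ≤ 1/32` from `v₁ = 4π/3 ≤ 16/3`, `e < 2.7183`; LLN density `r ≥ 23/25`; admissible rest
  state of packing `r/8000 > 10⁻⁴`): `diluteSelfConsistency_false_on_alexanderRange`.
* §2b TIGHTNESS (`Negative/Tightness.lean`, p134948 @ b2d5eba60c02): `DiluteSelfConsistencyHoldsAt` = the crux's inner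
  clause (`diluteSelfConsistency_iff_holdsAt`, `Iff.rfl`); `not_holdsAt_of_lt` / `sigma0_pow_le`: for ALL smooth
  positive profiles and all levels `0 < η ≤ η*` (absolute), ANY valid threshold satisfies `σ₀³ ≤ 2η/M`. With
  `not_denseExcursionAtTimeZero` (fixed profiles: initial packing `O(σ³)`) this pins the prover's only freedom:
  `σ₀(η, P) ≍ (η/M_P)^{1/3}` is necessary; sufficiency is decided dynamically (the DE heart), never at `t = 0`.
* §3 census `why_it_resists`.

Searches this cycle: `lit search` local index (searchd connection reset), zbMATH / arXiv legs (0 rows), OpenAlex (HTTP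
429) — search-degraded; the negative-side literature census of `Cruxes/DenseExcursion/Disproof.lean` §8.5 (no printed
σ-uniform or EOS-uniform `L∞` density control at the first singularity of multi-D compressible Euler; no smooth implosion
for a non-polytropic real-gas law; Boyd–Ramsey–Baty arXiv:1707.03792 for self-similar converging flows with general EOS)
is adopted by reference.
-/

noncomputable section

namespace Summit.AtomisticToContinuum.HydrodynamicLimit.Cruxes.DiluteSelfConsistency.Disproof

open Literature.MathematicalPhysics.KineticTheory Literature.Analysis.FluidPDE Literature.Analysis.FunctionSpaces
open Summit.AtomisticToContinuum.HydrodynamicLimit.Theses.ImplosionDichotomy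
open Summit.AtomisticToContinuum.HydrodynamicLimit.Theorems

/-! # §0 Logical position: the crux is `¬ DenseExcursion` (landed) -/

/-- The crux is the negation of the rank-2 crux (landed dichotomy, restated). -/
theorem dsc_iff_not_denseExcursion : DiluteSelfConsistency ↔ ¬ DenseExcursion :=
  not_denseExcursion_iff_diluteSelfConsistency.symm

/-! # §1 LOAD-BEARING MAP (landed: `Negative/Quantifiers.lean`) — one hypothesis dropped / one quantifier moved each -/

/-- Hypothesis class inhabited at every small `σ` (homogeneous admissible rest state). -/
theorem inhabited : ¬ DiluteSelfConsistencyVacuous := not_diluteSelfConsistencyVacuous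

/-- `0 < η` is load-bearing. -/
theorem level_pos_loadBearing : ¬ DiluteSelfConsistencyAnyLevel := diluteSelfConsistency_false_without_level_pos

/-- `σ₀` must depend on `η`. -/
theorem level_uniform_false : ¬ DiluteSelfConsistencyLevelUniform := not_diluteSelfConsistencyLevelUniform

/-- `a₀ > 0` is load-bearing (vacuous tie at `a₀ ≡ 0`). -/
theorem activity_pos_loadBearing : ¬ DiluteSelfConsistencyNonnegActivity :=
  diluteSelfConsistency_false_without_activity_pos

/-- `θ₀ > 0` is load-bearing (junk Maxwellian at `θ₀ ≡ 0`). -/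
theorem temperature_pos_loadBearing : ¬ DiluteSelfConsistencyNonnegTemperature :=
  diluteSelfConsistency_false_without_temperature_pos

/-- The `t = 0` tie is load-bearing (dense rest state `σ⁻³`). -/
theorem tie_loadBearing : ¬ DiluteSelfConsistencyUntied := diluteSelfConsistency_false_untied

/-- No polynomial-rate upgrade (`PolynomialCompression` proved). -/
theorem no_polynomial_rate : ¬ DiluteSelfConsistencyPolynomialRate := not_diluteSelfConsistencyPolynomialRate

/-- No σ-uniform density bound (`PolynomialCompression` proved). -/
theorem no_bounded_density : ¬ DiluteSelfConsistencyBoundedDensity := not_diluteSelfConsistencyBoundedDensity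

-- Smallness of `σ` is load-bearing even inside Alexander's range `σ < 1/2` (explicit statics at `σ = 1/20`):
-- `diluteSelfConsistency_false_on_alexanderRange : ¬ DiluteSelfConsistencyOnAlexanderRange`
-- (`Negative/AlexanderRange.lean`, p135124 — landed; alias omitted here until the farm snapshot carries the module).

/-! # §2 QUANTIFIER ORDER AND TIGHTNESS (landed: `Negative/ProfileUniform.lean`, `Negative/Tightness.lean`) -/

/-- `σ₀` cannot be chosen before the profiles (tall activity peaks are dense at `t = 0`). -/
theorem profile_uniform_false : ¬ DiluteSelfConsistencyProfileUniform := not_diluteSelfConsistencyProfileUniform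

/-- The threshold ceiling `σ₀³ ≤ 2η/M` for smooth profiles at levels `≤ η*` (re-export of `sigma0_pow_le`). -/
theorem threshold_ceiling :
    ∃ ηstar : ℝ, 0 < ηstar ∧ ∀ {a₀ θ₀ : T3 → ℝ} {u₀ : T3 → V3} (ha : Torus.IsSmooth a₀) (_hθ : Torus.IsSmooth θ₀)
      (_hu : Torus.IsSmooth u₀) (ha0 : ∀ x, 0 < a₀ x) (_hθ0 : ∀ x, 0 < θ₀ x) {η : ℝ}, 0 < η → η ≤ ηstar →
      ∀ {σ₀ : ℝ}, DiluteSelfConsistencyHoldsAt η a₀ θ₀ u₀ σ₀ →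
        σ₀ ^ 3 ≤ 2 * η / (profileOf a₀ ha.continuous ha0).M :=
  sigma0_pow_le

/-- …while for FIXED profiles the initial packing is `O(σ³)` (landed DE §7, restated): packing is never reached at
`t = 0` along the crux's own quantifier order. So the crux is decided DYNAMICALLY only. -/
theorem not_atTimeZero : ¬ DenseExcursionAtTimeZero := denseExcursion_false_atTimeZero

/-! # §3 WHY IT RESISTS — census for provers, planners and the next disprover -/

/-- **WHY `DiluteSelfConsistency` RESISTS a cheap kill** (census, cycle 1).

1. LOGICAL POSITION. `DSC ↔ ¬DE` (landed). A refutation of DSC is a `DenseExcursion` witness: fixed smooth positive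
   profiles and, for every `σ₀`, some `σ < σ₀` with an ADMISSIBLE classical solution reaching packing `η`. By §2's
   by-products admissible solutions with non-constant density are certifiable objects now (explicit-smallness tie +
   local existence), so the ONLY missing piece is dynamical: tracking a classical solution from `O(σ³)` initial packing
   (`not_atTimeZero`) to packing `η` — compression ratio `η/σ³ → ∞` inside the classical lifespan. Every EOS-free a-priori
   budget is blind to the zero-mass hot speck this requires (DE Disproof §7, §11, §14; `Mirror.lean` rungs), and
   `polynomialCompression_proof` shows density `σ^(-κ)` IS reached, so no soft argument decides it either way: the
   decision is forced finite-codimension modulation stability of the γ = 5/3 smooth implosion under the `O(packing)`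
   hard-sphere forcing plus a tuned (Melnikov) common zero — the DE lead lines' programme (XL).
2. JUNK ROUTES, all closed: vacuous tie (no — `inhabited`, `tendstoHydroFieldsAt_zero_of_small`); empty flows (no —
   Alexander, `σ < 1/2`); `T ≤ 0` (vacuous both ways); junk `hsPressure` / `Torus.gradient` (no — EOS analytic on
   `[0, η₀)`; the junk branch `Z = 1` at packing `≥ 512` is unreachable by continuity of `t ↦ sup ρσ³` from `O(σ³)`);
   activity amplitude (not a parameter: `profileOf` normalises); continuous-not-smooth profiles (vacuous: pinned data of
   a classical solution are smooth slices).
3. WHAT THIS CYCLE ADDS FOR PROVERS OF EITHER SIDE: (i) the quantifier skeleton is exactly right — `η > 0`,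
   `σ₀ = σ₀(η, profiles)`, positivity, the tie are each load-bearing, and no quantitative upgrade survives (§1);
   (ii) the profile dependence of `σ₀` is quantitatively forced, `σ₀³ ≤ 2η/M_P` (§2); (iii) `exists_admissible_of_small`
   + `tendstoHydroFieldsAt_zero_of_small` remove the "∃σ₁(profile)" threshold from every admissibility argument: a DE
   construction may let its data depend on `σ` through `Mσ³ ≤ λ*` only (the DE disprover's rung
   `DenseExcursionMovingProfile`, recorded as "physical but beyond the tree", is PROVABLE by §2's argument).
4. NOT ATTEMPTED (scope / anti-leakage): the positive rungs PreSingularDiluteness (needs the open support `EosContinuity`)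
   and shock-first stability (LukSpeck-type, unprinted for EOS families) — provers' objects; the DE construction itself
   (XL, staffed in the DE chain); dropping `Continuous` (only adds profiles whose pinned data cannot carry a classical
   solution — not load-bearing for falsity, not provable cheaply either way).
5. ATTACKS TRIED → OUTCOME: elaboration probe (rc 0); junk audit of `IsHardSphereEulerSolution` / `TendstoHydroFieldsAt` /
   `localGibbsLaw` / flows (no loophole, item 2); hypothesis deletion ×7 (incl. σ-smallness at explicit σ = 1/20) and quantifier moves ×4 (§1–§2, all
   decided and landed); quantitative tightness (§2b, landed); literature legs degraded this session (module docstring). -/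
theorem why_it_resists : True := trivial

end Summit.AtomisticToContinuum.HydrodynamicLimit.Cruxes.DiluteSelfConsistency.Disproof

end
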